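import Summits.NavierStokesRegularity.NavierStokesRegularity.Theses.AffineBernoulli
import Literature.Analysis.FluidPDE.DecayingSelfSimilarEulerProfile

/-!
# Birth skeleton (BC3) for crux `AffineBernoulli.EulerLerayLiouville` (stmt-NavierStokesRegularity-13660)

planner-skel-stmt-NavierStokesRegularity-13660-0 · skeleton-register (BC3, one-shot) · 2026-08-17.
Route `route-NavierStokesRegularity-AffineBernoulli` (rev 1, open), crux #2 (rank 2, OPEN, difficulty
open-problem; grounded NEW/open, checked rc 0 by nine refuters):

**EULER–LERAY LIOUVILLE** — if `W ∈ C²(ℝ³; ℝ³)` is divergence free, `P ∈ C¹`,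
`½W(y) + DW(y)[½(y−c) + W(y)] + ∇P(y) = 0` for all `y` (the stationary self-similar Euler system at
Leray's exponent `γ = ½` about the centre `c`), and `|W(y)| ≤ C⟨y⟩⁻¹`, `‖DW(y)‖ ≤ C⟨y⟩⁻²`, then
`W ≡ 0` — the Euler–Leray profile class `𝓔½` is trivial (exactly the critical decay for
Chae–Shvydkoy 2013 Thms 3.2/4.1; He's exterior-domain profiles have this tail).

## The line — FAR-FIELD BERNOULLI DATUM · FIRST-INTEGRAL RIGIDITY · ALIGNED STRATUM

The route's mechanism (card `leray-euler-affine-bernoulli`): at `γ = ½` — and only there — the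
profile equation is `∇ℋ = −Ω × V` (identity (B)), `V = ½(y−c) + W` the similarity (transport) field
with `div V = 3/2`, `Ω = curl W`, `ℋ = ½|V|² + P − ⅛|y−c|²` the self-similar Bernoulli function, and
`[V, Ω] = −(3/2)Ω` (identity (C)); so `ℋ` is a first integral of BOTH `V` and `Ω`. Both identities are
ALREADY PROVED IN THE TREE (`Literature.Analysis.FluidPDE.IsSelfSimilarEulerProfile.
gradient_selfSimilarBernoulli(_half)`, `.vorticity_eq_sub_form`, `.fderiv_selfSimilarBernoulli_transport`;
`Literature/Analysis/FluidPDE/DecayingSelfSimilarEulerProfile.lean` was written for this route and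
`isDecayingSelfSimilarEulerProfile_half_iff` identifies the crux's five inlined clauses with the tree
predicate `IsDecayingSelfSimilarEulerProfile (1/2) c W P`), so the support item
`AffineBernoulliIdentities` is NOT used as a stub (it would be a near-one-line stub). The route's own
two-layer plan reads `EulerLerayLiouville ⇐ AlignedStratumTrivial ∘ (no Bernoulli foliation)`; this
skeleton types it, factoring "no Bernoulli foliation" (= `ℋ` constant = `Ω × V ≡ 0`) through the far
field by a TRUE dynamical lemma:

* S1 `stub_similarityFirstIntegralRigidity` (NEW statement `SimilarityFirstIntegralRigidity`; TRUE,
  size L in Lean): FIRST INTEGRALS OF THE SIMILARITY FLOW ARE DETERMINED AT INFINITY — for `W ∈ C¹`,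
  `div W = 0`, with the `𝓔½` far field (`|W| ≤ C⟨y⟩⁻¹`, `‖DW‖ ≤ C⟨y⟩⁻²`), every differentiable
  `f : ℝ³ → ℝ` with `Df(y)[½(y−c) + W(y)] = 0` for all `y` and `f → h` at infinity is identically `h`.
  (No PDE. With `f = swirl W`, `h = 0` the same statement gives the swirl-extinction step `G ≡ 0` of
  support item `AxisymDecayingSwirlLiouville`, stmt-13905.)
* S2 `stub_bernoulliDatumTrivial` (NEW statement `BernoulliDatumTrivial`; OPEN — the HARDEST stub,
  the bet of the crux): THE FAR-FIELD BERNOULLI DATUM OF AN EULER–LERAY PROFILE IS CONSTANT — for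
  `(c, W, P) ∈ 𝓔½`, `ℋ = selfSimilarBernoulli (1/2) c W P` tends to some constant `h` at infinity
  (along `Filter.cocompact`). Within `𝓔½` this is equivalent to "`h_∞(θ) = ½ θ·σ(θ) + p_∞` is
  constant on `S²`", `σ(θ)/|y|` the leading far-field term of `W`, and then (zero flux of the
  divergence-free `W` through large spheres: `∫_{S²} θ·σ = 0`) to `θ·σ(θ) ≡ 0`: an Euler–Leray profile
  is asymptotically tangential. It is where the route's interior mechanism must bite (vorticity
  deserts at sources, Poincaré–Hopf, Bernoulli surfaces = `Aff⁺(ℝ)`-orbits swept to infinity and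
  pinned to the values of `ℋ` on the compact null invariant set `Inv(V)`).
* S3 `stub_alignedStratumTrivial` = route crux `AffineBernoulli.AlignedStratumTrivial` (stmt-13663,
  rank 5, difficulty M) BY NAME: a profile in `𝓔½` with `curl W × (½(y−c) + W) ≡ 0` vanishes.

Composition `EulerLerayLiouville_of : S1 → S2 → S3 → EulerLerayLiouville` (proved below, sorry-free,
standard axioms): given the five clauses, `isDecayingSelfSimilarEulerProfile_half_iff` puts `(c, W, P)`
in the tree class; S2 gives the limit `h` of `ℋ` at infinity; `ℋ` is differentiable
(`hasFDerivAt_selfSimilarBernoulli`) and `Dℋ[V] = (2γ−1)|V|² = 0` at `γ = ½`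
(`fderiv_selfSimilarBernoulli_transport`), so S1 (with `f = ℋ`, `W ∈ C¹` from `C²`, the decay clause
verbatim) gives `ℋ ≡ h`; hence `∇ℋ ≡ 0` (`gradient_fun_const`) and identity (B)
(`gradient_selfSimilarBernoulli`: `∇ℋ = (2γ−1)V − Ω × V`) gives `curl W × (½(y−c) + W) ≡ 0`; S3
concludes `W y = 0`.

## Why each stub is plausible, and what it leans on

* S1 (TRUE). `V = ½(y−c) + W` is `C¹` with `‖DV‖ ≤ ½ + C`, hence globally Lipschitz: complete `C¹`
  flow `Φ_s` (`Literature.Analysis.ODE.lipschitzFlow`, `hasDerivAt_lipschitzFlow`, `lipschitzFlow_add`,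
  `contDiff_lipschitzFlow`, `eq_lipschitzFlow_of_hasDerivAt`). `s ↦ f(Φ_s y)` has derivative
  `Df[V] = 0`: `f` is constant on orbits. Far field: `⟨V(y), y−c⟩ ≥ ½|y−c|² − C|y−c| ≥ ¼|y−c|²` for
  `|y−c| ≥ R₀ := 4C+1`, so `r(s) = |Φ_s y − c|²` obeys `r' ≥ ½ r` once `r ≥ R₀²`: every orbit that
  leaves `B̄(c, R₀)` tends to infinity (`cocompact`), whence `f(y) = lim f(Φ_s y) = h` off the set
  `K = {y | ∀ s ≥ 0, |Φ_s y − c| ≤ R₀}`. `K` is closed, bounded, `Φ_s K ⊆ K` for `s ≥ 0`, and by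
  Liouville's formula `det DΦ_s = exp ∫ div V = e^{3s/2}` (`div V = 3/2 + div W = 3/2`;
  `Literature.Analysis.ODE.det_eq_exp_mul_of_trace_eq`, pattern
  `Literature.Analysis.ODE.fderiv_localFlow_apply_field`, area formula
  `MeasureTheory.lintegral_abs_det_fderiv_eq_addHaar_image`) `vol(Φ_s K) = e^{3s/2} vol K ≤ vol B̄(c,R₀)`
  forces `vol K = 0`, so `Kᶜ` is dense and `f ≡ h` by continuity. The decay clause is used only for
  `W` bounded (outward pointing) and `DW` bounded (completeness); `div W = 0` is essential (with
  `div W ≤ −3/2` somewhere a bounded attracting region could carry other values of `f`).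
  [ArnoldKhesin1998 Ch. II §1; arXiv:1901.09426 §2.3 (the swirl case); ConstantinIgnatovaVicol2026Putative §3.4]
* S2 (OPEN; implied by the crux: `W ≡ 0` ⇒ `ℋ = P` with `∇P = 0`, constant). No counterexample is
  known inside `𝓔½` (nine refuter passes on stmt-13660: potential flows, affine fields, pure swirl,
  harmonic gradients all die on decay + smoothness); He's `γ = ½` profiles live on EXTERIOR domains
  (doi:10.1007/s00021-005-0205-3), where the far-field datum `σ(θ)` is free — the stub says that a
  completion to all of `ℝ³` pins the radial far-field flux density `θ·σ(θ)` to zero. WHY IT MIGHT FAIL: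
  a smooth completion across a saddle-type stagnation set with `θ·σ ≢ 0` (it would be Hou's steady
  `γ = ½` skeleton); the decay class is exactly critical (ChaeShvydkoy2013 Thms 3.2/4.1 need `W ∈ L³` /
  `Ω ∈ L^p`, `p < 3/2`). Leans on: `Literature.Analysis.FluidPDE.IsDecayingSelfSimilarEulerProfile`
  API (`.isSelfSimilarEulerProfile`, `.bernoulliForm`, `.vorticity_eq_sub_form`, `.curl_decay`),
  `selfSimilarBernoulli`, `IsSelfSimilarEulerProfile.fderiv_selfSimilarBernoulli_transport`
  (`V·∇ℋ = 0`), `inner_cross_curl_left` (`Ω·∇ℋ = 0`), route supports `VorticityDesert` (stmt-13665)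
  and S1; far-field asymptotics / Poincaré–Hopf / invariant-manifold theory are NOT in the tree.
  [ChaeShvydkoy2013, doi:10.1007/s00021-005-0205-3, ConstantinIgnatovaVicol2026Putative,
  arXiv:1901.09426, ArnoldKhesin1998, Hou2022PotentiallySingularNS]
* S3 (route crux stmt-13663, checked/grounded with the route; refuter g41-25 reduced it to a div–curl
  statement with a noted gap at equilibria with unstable rate `≥ 3/2`). At `γ = ½` the aligned ansatz
  `Ω = λV`, `V·∇λ = −(3/2)λ` is kinematically consistent (`div V = 3/2`), so this is a genuine stratum;
  `λ` is transported with weight `−3/2` along `V`. [ArnoldKhesin1998, ConstantinIgnatovaVicol2026Putative,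
  Chae2007CMPEuler]

## Disproof used / negatives / dead lines

No `Disproof.lean`, no `Negative/` lemma, no crux idea and no earlier line exist for this crux
(`Cruxes/EulerLerayLiouville/` did not exist before this file, 2026-08-17) — there is no
`_false_without_<H>` obligation to honour. Refuter evidence on stmt-13660 (g41-25/28/35/43, g43-4/14,
g44-6/12/16/33): statement survives; DECAY and SMOOTHNESS are load-bearing (harmonic gradients `∇φ`
solve the profile equation and are killed only by decay; He's exterior profiles by smoothness across
the stagnation set) — honoured: S1 consumes boundedness of `W`, `DW` and `div W = 0`, S2 is stated on
the full class, S3 verbatim. Negatives index (last readable copy, sibling registrar 2026-08-17: 4055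
FiniteTangentModuli, 1832 PerpetualPump.Thesis, 1429 CorrectorSolvable, 0154 BlowupClayNonuniqueness):
none concerns self-similar Euler profiles, first integrals or Bernoulli functions; no stub restates one.

## BC3 audit (registrar; raw outputs in the registrar's NOTES.md / `bc/` folder and `Lines/birth.md`)

`lean check --json`: rc 0, sorries = 3 = the three `stub_*` (zero elsewhere; `EulerLerayLiouville_of`
standard axioms). Probes (files importing ONLY this route file — hence the Statement — and
`Literature.Analysis.FluidPDE.DecayingSelfSimilarEulerProfile`, with S1/S2 re-declared verbatim, one
tactic per `example`, `maxHeartbeats 400000`): `S → EulerLerayLiouville` and `S → NavierStokesRegularity`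
by `exact?` · `simpa` · `simpa [defs]` · `aesop` · `unfold; aesop` must FAIL for S1, S2, S3 — results in
`Lines/birth.md`.
-/

noncomputable section

set_option linter.dupNamespace false

namespace Summit.NavierStokesRegularity.NavierStokesRegularity.Cruxes.EulerLerayLiouville.Birth

open Summit.NavierStokesRegularity.NavierStokesRegularity.Theses.AffineBernoulli
open Literature.Analysis.FluidPDE

/-! ## The two new statements of the line (S1, S2); S3 is the route item `AlignedStratumTrivial` -/

/-- **S1 statement — FIRST INTEGRALS OF THE SIMILARITY FLOW ARE DETERMINED AT INFINITY.** For a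
centre `c` and a `C¹`, divergence-free `W : ℝ³ → ℝ³` with the `𝓔½` far field
(`|W(y)| ≤ C(1+|y|)⁻¹`, `‖DW(y)‖ ≤ C((1+|y|)²)⁻¹`), every differentiable `f : ℝ³ → ℝ` that is a first
integral of the similarity field `V = ½(y−c) + W` (`Df(y)[V(y)] = 0` for all `y`) and tends to `h`
at infinity is identically `h`. (Complete expanding flow, `div V = 3/2`: the bounded invariant set is
Lebesgue-null, the basin of infinity is dense.) [ArnoldKhesin1998 Ch. II; arXiv:1901.09426 §2.3] -/
def SimilarityFirstIntegralRigidity : Prop :=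
  ∀ (c : EuclideanSpace ℝ (Fin 3)) (W : EuclideanSpace ℝ (Fin 3) → EuclideanSpace ℝ (Fin 3))
    (f : EuclideanSpace ℝ (Fin 3) → ℝ) (h : ℝ),
    ContDiff ℝ 1 W → Literature.Analysis.FluidPDE.VectorCalculus.IsDivFree W →
    (∃ C : ℝ, ∀ y, ‖W y‖ ≤ C * (1 + ‖y‖)⁻¹ ∧ ‖fderiv ℝ W y‖ ≤ C * ((1 + ‖y‖) ^ 2)⁻¹) →
    Differentiable ℝ f →
    (∀ y, fderiv ℝ f y ((1 / 2 : ℝ) • (y - c) + W y) = 0) →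
    Filter.Tendsto f (Filter.cocompact (EuclideanSpace ℝ (Fin 3))) (nhds h) →
    ∀ y, f y = h

/-- **S2 statement — THE FAR-FIELD BERNOULLI DATUM OF AN EULER–LERAY PROFILE IS CONSTANT.** For
`(c, W, P)` in the Euler–Leray class `𝓔½` (tree predicate
`Literature.Analysis.FluidPDE.IsDecayingSelfSimilarEulerProfile (1/2) c W P` = the five clauses of
`EulerLerayLiouville`, `isDecayingSelfSimilarEulerProfile_half_iff`), the self-similar Bernoulli
function `ℋ = ½|½(y−c) + W|² + P − ⅛|y−c|²` (`selfSimilarBernoulli (1/2) c W P`) tends to a constant at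
infinity. Within `𝓔½`: `h_∞(θ) = ½θ·σ(θ) + p_∞` constant ⇔ the radial far-field flux density
`θ·σ(θ)` vanishes identically. OPEN; implied by the crux. [ChaeShvydkoy2013; doi:10.1007/s00021-005-0205-3;
ConstantinIgnatovaVicol2026Putative §3.4.3; arXiv:1901.09426; ArnoldKhesin1998] -/
def BernoulliDatumTrivial : Prop :=
  ∀ (c : EuclideanSpace ℝ (Fin 3)) (W : EuclideanSpace ℝ (Fin 3) → EuclideanSpace ℝ (Fin 3))
    (P : EuclideanSpace ℝ (Fin 3) → ℝ),
    Literature.Analysis.FluidPDE.IsDecayingSelfSimilarEulerProfile (1 / 2) c W P →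
    ∃ h : ℝ, Filter.Tendsto (Literature.Analysis.FluidPDE.selfSimilarBernoulli (1 / 2) c W P)
      (Filter.cocompact (EuclideanSpace ℝ (Fin 3))) (nhds h)

/-! ## The stubs S1–S3 (the only `sorry`s of the file) -/

/-- **S1 `stub_similarityFirstIntegralRigidity`** (= `SimilarityFirstIntegralRigidity`; TRUE, size L:
`lipschitzFlow` of the globally Lipschitz `V = ½(y−c) + W`, outward pointing for `|y−c| ≥ 4C+1`,
Liouville `det DΦ_s = e^{3s/2}` ⇒ the bounded forward-invariant set is null ⇒ dense basin of infinity,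
constancy of `f` on orbits, continuity). Leans on: `Literature.Analysis.ODE.lipschitzFlow` API,
`Literature.Analysis.ODE.det_eq_exp_mul_of_trace_eq`, `Literature.Analysis.ODE.fderiv_localFlow_apply_field`,
Mathlib `MeasureTheory.lintegral_abs_det_fderiv_eq_addHaar_image`, `VectorCalculus.divergence`. -/
theorem stub_similarityFirstIntegralRigidity : SimilarityFirstIntegralRigidity := by
  sorry

/-- **S2 `stub_bernoulliDatumTrivial`** (= `BernoulliDatumTrivial`; OPEN — the hardest stub, the
bet of the crux: the interior structure of a complete `γ = ½` profile — vorticity deserts at the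
sources of `V` (route support `VorticityDesert`), index sum `+1` of `V`, Bernoulli surfaces swept to
infinity and pinned to the values of `ℋ` on the compact null invariant set `Inv(V)` — must exhaust
the far-field datum `h_∞`). Leans on: `IsDecayingSelfSimilarEulerProfile` API, `.bernoulliForm`,
`.vorticity_eq_sub_form`, `.curl_decay`, `fderiv_selfSimilarBernoulli_transport`,
`inner_cross_curl_left`, S1, `VorticityDesert`. -/
theorem stub_bernoulliDatumTrivial : BernoulliDatumTrivial := by
  sorry

/-- **S3 `stub_alignedStratumTrivial`** (= route crux `AffineBernoulli.AlignedStratumTrivial`,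
stmt-NavierStokesRegularity-13663, verbatim BY NAME; difficulty M): a profile in `𝓔½` whose vorticity
is everywhere parallel to the similarity field (`curl W × (½(y−c) + W) ≡ 0`, i.e. no Bernoulli
foliation) vanishes identically. Landing it (`propose … --supports stmt-NavierStokesRegularity-13660`)
also closes stmt-13663. -/
theorem stub_alignedStratumTrivial :
    Summit.NavierStokesRegularity.NavierStokesRegularity.Theses.AffineBernoulli.AlignedStratumTrivial := by
  sorry

/-! ## Name-keyed aliases of the two new statements — the hypotheses of `EulerLerayLiouville_of`

The native skeleton audit (`#h21_check_skeleton`, run by `ledger skeleton check`) admits a hypothesis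
of the composing theorem only if its head constant is a registered obligation (S3: the route item, by
name) or is NAMED like a declared stub; `__Registered.stub_X` is statement `X` under the registered
stub's short name (device of `Cruxes/ClockLaw/Lines/birth.lean`). Each alias is an `abbrev`,
definitionally its statement. -/
namespace __Registered

/-- Alias of `SimilarityFirstIntegralRigidity` keyed by the registered stub name. -/
abbrev stub_similarityFirstIntegralRigidity : Prop := SimilarityFirstIntegralRigidity
/-- Alias of `BernoulliDatumTrivial` keyed by the registered stub name. -/
abbrev stub_bernoulliDatumTrivial : Prop := BernoulliDatumTrivial

end __Registered

/-! ## The composition (kernel-checked, sorry-free): S1 → S2 → S3 → the crux, BY NAME -/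

/-- **`EulerLerayLiouville` from the three stub statements.** Given `(c, W, P)` with the five clauses:
the tree class `𝓔½` (`isDecayingSelfSimilarEulerProfile_half_iff`); S2: `ℋ → h` at infinity; `ℋ` is a
differentiable first integral of `V = ½(y−c) + W` (`hasFDerivAt_selfSimilarBernoulli`,
`fderiv_selfSimilarBernoulli_transport` at `γ = ½`), so S1 gives `ℋ ≡ h`; then `∇ℋ ≡ 0` and identity
(B) `∇ℋ = (2γ−1)V − curl W × V` (`gradient_selfSimilarBernoulli`) give the aligned stratum
`curl W × V ≡ 0`; S3 gives `W ≡ 0`. Hypotheses = the registered stubs' statements (S1, S2 via their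
name-keyed aliases, S3 the route item by name); conclusion = the route decl, literally. -/
theorem EulerLerayLiouville_of :
    __Registered.stub_similarityFirstIntegralRigidity → __Registered.stub_bernoulliDatumTrivial →
    Summit.NavierStokesRegularity.NavierStokesRegularity.Theses.AffineBernoulli.AlignedStratumTrivial →
      Summit.NavierStokesRegularity.NavierStokesRegularity.Theses.AffineBernoulli.EulerLerayLiouville := by
  intro hFill hFar hAligned c W P hW2 hP1 hdiv heq hdec y
  -- the five inlined clauses are the tree class `𝓔½`
  have hE : IsDecayingSelfSimilarEulerProfile (1 / 2) c W P :=
    isDecayingSelfSimilarEulerProfile_half_iff.2 ⟨hW2, hP1, hdiv, heq, hdec⟩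
  have hprof : IsSelfSimilarEulerProfile (1 / 2) c W P := hE.isSelfSimilarEulerProfile
  -- S2: the far-field Bernoulli datum is a constant `h`
  obtain ⟨h, hh⟩ := hFar c W P hE
  -- `ℋ` is differentiable and a first integral of `V` (transport identity (3.31) at `γ = ½`)
  have hdW : Differentiable ℝ W := hprof.differentiable_velocity
  have hdP : Differentiable ℝ P := hprof.differentiable_pressure
  have hHd : Differentiable ℝ (selfSimilarBernoulli (1 / 2) c W P) := fun z =>
    (hasFDerivAt_selfSimilarBernoulli (γ := (1 / 2 : ℝ)) (c := c) (hdW z) (hdP z)).differentiableAt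
  have hHV : ∀ z, fderiv ℝ (selfSimilarBernoulli (1 / 2) c W P) z ((1 / 2 : ℝ) • (z - c) + W z) = 0 := by
    intro z
    have e := hprof.fderiv_selfSimilarBernoulli_transport z
    rw [selfSimilarTransport_apply, show (2 * (1 / 2 : ℝ) - 1) = 0 by norm_num, zero_mul] at e
    exact e
  -- S1: `ℋ ≡ h`
  have hconst : ∀ z, selfSimilarBernoulli (1 / 2) c W P z = h :=
    hFill c W (selfSimilarBernoulli (1 / 2) c W P) h (hW2.of_le (by norm_num)) hdiv hdec hHd hHV hh
  -- identity (B): `∇ℋ = (2γ−1)V − curl W × V` with `∇ℋ = 0` and `2γ − 1 = 0`: the aligned stratum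
  have halign : ∀ z, cross (curl W z) ((1 / 2 : ℝ) • (z - c) + W z) = 0 := by
    intro z
    have hg := hprof.gradient_selfSimilarBernoulli z
    have hfun : selfSimilarBernoulli (1 / 2) c W P = fun _ => h := funext hconst
    rw [hfun, gradient_fun_const, selfSimilarTransport_apply,
      show (2 * (1 / 2 : ℝ) - 1) = 0 by norm_num, zero_smul, zero_sub] at hg
    exact neg_eq_zero.mp hg.symm
  -- S3: an aligned profile is trivial
  exact hAligned c W P hW2 hP1 hdiv heq hdec halign y

/-- WIRING CHECK: the three sorried stubs compose to a closed term of the crux's type (modulo their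
`sorry`s). Deliberately an `example` — no constant of type `EulerLerayLiouville` enters the
environment, so a probe importing this file could not close `stub → EulerLerayLiouville` by `exact?`
through a pre-composed witness (the registrar's probes do not import this file at all). -/
example : Summit.NavierStokesRegularity.NavierStokesRegularity.Theses.AffineBernoulli.EulerLerayLiouville :=
  EulerLerayLiouville_of stub_similarityFirstIntegralRigidity stub_bernoulliDatumTrivial
    stub_alignedStratumTrivial

end Summit.NavierStokesRegularity.NavierStokesRegularity.Cruxes.EulerLerayLiouville.Birth

end
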